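import Literature.AlgebraicGeometry.Resolution.HenselLift
import Literature.AlgebraicGeometry.Resolution.HenselizedRationalTameExtensions
import Literature.AlgebraicGeometry.Resolution.HenselsLemmaProofs
import Literature.AlgebraicGeometry.Resolution.KnafKuhlmann2009Lemma21
import Literature.AlgebraicGeometry.Resolution.KnafKuhlmann2009Thm11Parts
import Mathlib.FieldTheory.Perfect
import HarnessLib

/-!
# A henselian extension in which a perfect ground field is algebraically closed is immediate

Topic: `Literature/AlgebraicGeometry/Resolution` (valued function fields). PROVED input of the
reduction of M. Temkin, *Inseparable local uniformization*, J. Algebra 373 (2013) =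
arXiv:0804.1554, Thm. 3.2.3 to its split case (Step 2 of its proof, p. 24 of the held arXiv
text: "If `L ⊂ K` is the completion of the field `K ∩ k^a` … then `L` is algebraically closed
in `K` … `K` is a one-dimensional `L`-field of type 4 … In addition, `K` is `L`-split by
Corollary 3.1.10"), in the henselian rendering of the companion files
(`DeeplyRamifiedSplit.lean`, `HenselianRationalityPerfectSplit.lean`): over the relative
algebraic closure `C` of a perfect ground field inside a henselian `E`, the extension `E|C` —
a priori only transcendentally immediate (`vE/vC` torsion, `Ev|Cv` algebraic: "type 4") — is in
fact IMMEDIATE, so that the henselian-rationality machinery of Kuhlmann 2019 (which is about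
immediate function fields) applies over `C`.

Mechanism (classical, Hensel's Lemma; `C` perfect of residue characteristic `p`): a residue of
`E` algebraic over the perfect `Cv` is separable over it, hence lifts to a root IN `E` of a monic
lift of its minimal polynomial — an element algebraic over `C`, i.e. of `C`; a value `γ ∈ vE` with
`p^s m γ ∈ vC` has `mγ ∈ vC` (`vC` is `p`-divisible) and then, `m` being prime to `p`, an element
of value `γ` differs from an `m`-th root of an element of `C` by a unit factor which is an `m`-th
power in `E` (Hensel) — again producing an element of `E` algebraic over `C`.

## Content (everything PROVED; no definitions, no named facts)

* `resField_eq_residueSubfield` — the two renderings of `Mv ⊆ Ωv` in the tree agree.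
* `perfectField_residueSubfield_of_perfect` — `Cv` is perfect for perfect `C`.
* `residue_mem_resField_of_forall_isAlgebraic_mem` — residues of `E` algebraic over `Cv` lie in
  `Cv`.
* `exists_valuation_eq_of_forall_isAlgebraic_mem` — values of `E` torsion over `vC` lie in `vC`.
* `isImmediateOver_of_forall_isAlgebraic_mem` — **`(E|C, V)` is immediate**.

## Sources

* M. Temkin, J. Algebra 373 (2013) = arXiv:0804.1554: Thm. 3.2.3, proof, Step 2 (p. 24);
  §3.2 (types of one-dimensional fields). [Temkin2013]
* F.-V. Kuhlmann, *Elimination of ramification I*, Trans. AMS 362 (2010) = arXiv:1003.5678: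
  §1.1 (Hensel's Lemma), §2.2 (roots of `1`-units), §2.5 (lifting residue field extensions) —
  the tools, in the tree as `Kuhlmann2010HenselsLemma_holds`,
  `exists_pow_eq_of_valuation_sub_one_lt`, `exists_root_lift_of_henselianLocalRing`. [Kuhlmann2010]

## Rendering notes

Ambient rendering of the companion files: subfields `C ≤ E` of a valued field `(Ω, V)` whose
residue field has characteristic `p`; "perfect" = every element of `C` is a `p`-th power in `C`;
"henselian" = `IsHenselianField` (`Henselization.lean`); immediateness = `IsImmediateOver`
(`KnafKuhlmann2009Thm11Parts.lean`).
-/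

noncomputable section

namespace Literature.AlgebraicGeometry.Resolution

universe u

open Polynomial IsLocalRing

variable {Ω : Type u} [Field Ω] (V : ValuationSubring Ω)

/-! ### The two renderings of the residue field of a subfield agree -/

/-- `resField V M` (`ValuedFunctionFields.lean`) and `residueSubfield M V` (`ValuationDefect.lean`)
are the same subfield of `Ωv`: the residues of the elements of `V ∩ M`. [folklore] -/
theorem resField_eq_residueSubfield (M : Subfield Ω) : resField V M = residueSubfield M V := by
  ext r
  rw [mem_resField_iff, mem_residueSubfield_iff]
  constructor
  · rintro ⟨a, haM, rfl⟩
    exact ⟨⟨a, haM⟩, a.2, rfl⟩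
  · rintro ⟨c, hc, rfl⟩
    exact ⟨⟨(c : Ω), hc⟩, c.2, rfl⟩

section Perfect

variable (p : ℕ) [hp : Fact p.Prime] [CharP (ResidueField V) p]

/-- The residue field of a perfect subfield is perfect (the residue of `b` with `b^p = y` is a
`p`-th root of the residue of `y`; `b ∈ V` as `|b|^p = |y| ≤ 1`). [folklore] -/
theorem perfectField_residueSubfield_of_perfect {C : Subfield Ω}
    (hperf : ∀ y ∈ C, ∃ b ∈ C, b ^ p = y) : PerfectField (residueSubfield C V) := by
  haveI : ExpChar (residueSubfield C V) p := ExpChar.prime hp.out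
  haveI : PerfectRing (residueSubfield C V) p := by
    refine PerfectRing.ofSurjective _ p fun s => ?_
    obtain ⟨c, hcV, hcs⟩ := (mem_residueSubfield_iff C V s.1).mp s.2
    obtain ⟨b, hbC, hb⟩ := hperf (c : Ω) c.2
    have hbV : b ∈ V := by
      rw [← V.valuation_le_one_iff]
      by_contra hlt
      push Not at hlt
      have h1 : 1 < V.valuation (b ^ p) := by
        rw [map_pow]; exact one_lt_pow₀ hlt hp.out.ne_zero
      rw [hb] at h1
      exact absurd ((V.valuation_le_one_iff _).mpr hcV) (not_le.mpr h1)
    refine ⟨⟨residue V ⟨b, hbV⟩, (mem_residueSubfield_iff C V _).mpr ⟨⟨b, hbC⟩, hbV, rfl⟩⟩,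
      Subtype.ext ?_⟩
    rw [frobenius_def]
    change residue V ⟨b, hbV⟩ ^ p = (s : ResidueField V)
    rw [← hcs, ← map_pow]
    congr 1
    exact Subtype.ext hb
  exact PerfectRing.toPerfectField _ p

/-- **Residues: no new algebraic residues.** Let `C ≤ E ≤ Ω` be subfields with `C` perfect
(characteristic `p`), `(E, V ∩ E)` henselian, and such that every element of `E` algebraic over
`C` lies in `C`. Then every residue of an element of `V ∩ E` which is algebraic over `Cv` lies in
`Cv`: its (separable, `Cv` being perfect) minimal polynomial lifts to a monic polynomial over
`V ∩ C` of which it is a simple root modulo `𝔪`, so Hensel's Lemma in `E` produces a root in `E`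
with that residue — an element of `E` algebraic over `C`, i.e. of `C`. [folklore] -/
theorem residue_mem_resField_of_forall_isAlgebraic_mem {C E : Subfield Ω} (hCE : C ≤ E)
    (hperf : ∀ y ∈ C, ∃ b ∈ C, b ^ p = y)
    (hE : IsHenselianField E (V.comap (algebraMap E Ω)))
    (hrel : ∀ a ∈ E, IsAlgebraic C a → a ∈ C) {r : Ω} (hrE : r ∈ E) (hrV : r ∈ V)
    (halg : IsAlgebraic (resField V C) (residue V ⟨r, hrV⟩)) :
    residue V ⟨r, hrV⟩ ∈ resField V C := by
  classical
  haveI : PerfectField (residueSubfield C V) := perfectField_residueSubfield_of_perfect V p hperf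
  have hHens : HenselianLocalRing (V.comap (algebraMap E Ω)) :=
    Kuhlmann2010HenselsLemma_holds _ _ hE
  set rbar := residue V ⟨r, hrV⟩ with hrbar
  have halg' : IsAlgebraic (residueSubfield C V) rbar := by
    rw [← resField_eq_residueSubfield]; exact halg
  have hint : IsIntegral (residueSubfield C V) rbar := halg'.isIntegral
  set gbar := minpoly (residueSubfield C V) rbar with hgbar
  have hmon : gbar.Monic := minpoly.monic hint
  have hirr : Irreducible gbar := minpoly.irreducible hint
  have hsep : gbar.Separable := PerfectField.separable_of_irreducible hirr
  have hroot : aeval rbar gbar = 0 := minpoly.aeval _ _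
  have hsimple : aeval rbar (derivative gbar) ≠ 0 := hsep.aeval_derivative_ne_zero hroot
  have hrbarE : rbar ∈ residueSubfield E V :=
    (mem_residueSubfield_iff E V _).mpr ⟨⟨r, hrE⟩, hrV, rfl⟩
  obtain ⟨g, y, hyV, hgmon, -, -, hyE, hyg, hyres⟩ :=
    exists_root_lift_of_henselianLocalRing V hCE hHens gbar hmon hirr hrbarE hroot hsimple
  -- `y ∈ E` is algebraic over `C`, hence in `C`
  have hyalg : IsAlgebraic C y := ⟨g, hgmon.ne_zero, hyg⟩
  have hyC : y ∈ C := hrel y hyE hyalg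
  rw [← hyres]
  exact residue_mem_resField V ⟨y, hyV⟩ hyC

/-- **Values: no new torsion values.** Under the same hypotheses, if moreover every residue of
`V ∩ E` is algebraic over `Cv`, then every `a ∈ E^×` whose value is torsion modulo `vC` has its
value in `vC`: writing the order as `p^s m`, the `p`-part is removed because `vC` is
`p`-divisible (`C` perfect), and for `m` prime to `p`, `a^m = b'·u` with `b' ∈ C` and a unit `u`
whose residue lies in `Cv` (previous lemma), so `u = c·wᵐ` with `c ∈ C` and a `1`-unit `m`-th root
`w ∈ E` (Hensel's Lemma); then `(a/w)^m = b'c ∈ C`, so `a/w ∈ E` is algebraic over `C`, i.e. in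
`C`, and `|a| = |a/w|`. [folklore] -/
theorem exists_valuation_eq_of_forall_isAlgebraic_mem {C E : Subfield Ω} (hCE : C ≤ E)
    (hperf : ∀ y ∈ C, ∃ b ∈ C, b ^ p = y)
    (hE : IsHenselianField E (V.comap (algebraMap E Ω)))
    (hrel : ∀ a ∈ E, IsAlgebraic C a → a ∈ C)
    (hresalg : ∀ (r : Ω) (hrE : r ∈ E) (hrV : r ∈ V), IsAlgebraic (resField V C) (residue V ⟨r, hrV⟩))
    {a : Ω} (haE : a ∈ E) (ha0 : a ≠ 0)
    (htors : ∃ n : ℕ, n ≠ 0 ∧ ∃ b ∈ C, V.valuation (a ^ n) = V.valuation b) :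
    ∃ b ∈ C, V.valuation a = V.valuation b := by
  classical
  have hHens : HenselianLocalRing (V.comap (algebraMap E Ω)) :=
    Kuhlmann2010HenselsLemma_holds _ _ hE
  -- remove the `p`-part of the exponent
  have hred : ∀ n : ℕ, n ≠ 0 → (∃ b ∈ C, V.valuation (a ^ n) = V.valuation b) →
      ∃ m : ℕ, m ≠ 0 ∧ ¬ p ∣ m ∧ ∃ b ∈ C, V.valuation (a ^ m) = V.valuation b := by
    intro n
    induction n using Nat.strong_induction_on with
    | _ n ih =>
      intro hn hb
      by_cases hpn : p ∣ n
      · obtain ⟨n', rfl⟩ := hpn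
        have hn' : n' ≠ 0 := fun h => hn (by rw [h, mul_zero])
        obtain ⟨b, hbC, hb⟩ := hb
        obtain ⟨b₁, hb₁C, hb₁⟩ := hperf b hbC
        have h1 : V.valuation (a ^ n') = V.valuation b₁ := by
          apply pow_left_injective hp.out.ne_zero
          change V.valuation (a ^ n') ^ p = V.valuation b₁ ^ p
          rw [← map_pow, ← map_pow, ← pow_mul, mul_comm, hb, hb₁]
        have hlt : n' < p * n' := lt_mul_left (Nat.pos_of_ne_zero hn') hp.out.one_lt
        exact ih n' hlt hn' ⟨b₁, hb₁C, h1⟩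
      · exact ⟨n, hn, hpn, hb⟩
  obtain ⟨n, hn0, hb⟩ := htors
  obtain ⟨m, hm0, hpm, b', hb'C, hb'⟩ := hred n hn0 hb
  -- `a^m = b' u`, `u` a unit of `V ∩ E` with residue in `Cv`
  have ham0 : a ^ m ≠ 0 := pow_ne_zero _ ha0
  have hb'0 : b' ≠ 0 := by
    rintro rfl
    rw [map_zero, map_eq_zero] at hb'
    exact ham0 hb'
  have hvb'0 : V.valuation b' ≠ 0 := (_root_.map_ne_zero _).mpr hb'0
  set u : Ω := a ^ m / b' with hu
  have huE : u ∈ E := div_mem (pow_mem haE m) (hCE hb'C)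
  have hvu : V.valuation u = 1 := by rw [hu, map_div₀, hb', div_self hvb'0]
  have huV : u ∈ V := (V.valuation_le_one_iff u).mp hvu.le
  have hures : residue V ⟨u, huV⟩ ∈ resField V C :=
    residue_mem_resField_of_forall_isAlgebraic_mem V p hCE hperf hE hrel huE huV (hresalg u huE huV)
  obtain ⟨c, hcC, hcu⟩ := (mem_resField_iff V C _).mp hures
  -- `c` is a unit and `u/c` a `1`-unit
  have hvuc : V.valuation (u - c) < 1 := by
    have h := (residue_eq_residue_iff V ⟨u, huV⟩ c).mp hcu.symm
    exact h
  have hvc : V.valuation (c : Ω) = 1 := by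
    have hid : (c : Ω) = u - (u - c) := by ring
    rw [hid, Valuation.map_sub_eq_of_lt_left _ (by rw [hvu]; exact hvuc), hvu]
  have hc0 : (c : Ω) ≠ 0 := fun h0 => by rw [h0, map_zero] at hvc; exact zero_ne_one hvc
  have hvc0 : V.valuation (c : Ω) ≠ 0 := (_root_.map_ne_zero _).mpr hc0
  have h1u : V.valuation (u / c - 1) < 1 := by
    have hid : u / c - 1 = (u - c) / c := by field_simp
    rw [hid, map_div₀, hvc, div_one]
    exact hvuc
  -- Hensel: `u/c = w^m`, `w` a `1`-unit of `E`
  have hmres : (m : ResidueField V) ≠ 0 := by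
    rw [Ne, CharP.cast_eq_zero_iff (ResidueField V) p]
    exact hpm
  obtain ⟨w, hwE, hwm, hw1⟩ :=
    exists_pow_eq_of_valuation_sub_one_lt V hHens hmres (div_mem huE (hCE hcC)) h1u
  have hvw : V.valuation w = 1 := by
    have hid : w = 1 + (w - 1) := by ring
    rw [hid, Valuation.map_add_eq_of_lt_left _ (by rw [Valuation.map_one]; exact hw1),
      Valuation.map_one]
  have hw0 : w ≠ 0 := fun h0 => by rw [h0, map_zero] at hvw; exact zero_ne_one hvw
  -- `(a/w)^m = b' c ∈ C`, so `a/w ∈ C`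
  have hpow : (a / w) ^ m = b' * c := by
    rw [div_pow, hwm, hu]
    field_simp
  have halg : IsAlgebraic C (a / w) := by
    refine ⟨X ^ m - Polynomial.C (⟨b' * c, C.mul_mem hb'C hcC⟩ : C), ?_, ?_⟩
    · exact (monic_X_pow_sub_C _ hm0).ne_zero
    · rw [map_sub, map_pow, aeval_X, aeval_C, hpow]
      exact sub_self _
  have hawC : a / w ∈ C := hrel _ (div_mem haE hwE) halg
  refine ⟨a / w, hawC, ?_⟩
  rw [map_div₀, hvw, div_one]

/-- **A henselian extension in which the perfect ground field is algebraically closed, with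
torsion value group and algebraic residue field over it, is IMMEDIATE.** For subfields `C ≤ E` of
`Ω` (characteristic `p`, residue characteristic `p`) with `C` perfect, `(E, V ∩ E)` henselian,
every element of `E` algebraic over `C` lying in `C`, `vE/vC` torsion and `Ev|Cv` algebraic:
`(E|C, V)` is immediate (`IsImmediateOver`). (In the setting of Temkin 2013, Thm. 3.2.3, Step 2 —
`K` transcendentally immediate ("type 4") over the deeply ramified `k`, `L` the algebraic closure
of `k` in `K` — this says that `K/L` is immediate, not merely transcendentally immediate.)
PROVED from the two preceding lemmas. [folklore] -/
theorem isImmediateOver_of_forall_isAlgebraic_mem {C E : Subfield Ω} (hCE : C ≤ E)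
    (hperf : ∀ y ∈ C, ∃ b ∈ C, b ^ p = y)
    (hE : IsHenselianField E (V.comap (algebraMap E Ω)))
    (hrel : ∀ a ∈ E, IsAlgebraic C a → a ∈ C)
    (htors : ∀ a ∈ E, a ≠ 0 → ∃ n : ℕ, n ≠ 0 ∧ ∃ b ∈ C, V.valuation (a ^ n) = V.valuation b)
    (hresalg : ∀ (r : Ω) (hrE : r ∈ E) (hrV : r ∈ V), IsAlgebraic (resField V C) (residue V ⟨r, hrV⟩)) :
    IsImmediateOver V C E := by
  refine ⟨fun a haE ha0 => exists_valuation_eq_of_forall_isAlgebraic_mem V p hCE hperf hE hrel hresalg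
    haE ha0 (htors a haE ha0), fun s hs => ?_⟩
  obtain ⟨r, hrE, rfl⟩ := (mem_resField_iff V E s).mp hs
  exact residue_mem_resField_of_forall_isAlgebraic_mem V p hCE hperf hE hrel hrE r.2 (hresalg r hrE r.2)

end Perfect

end Literature.AlgebraicGeometry.Resolution
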